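import Summits.QuantumFields.YangMills.Theorems.AllWindowsColdBoxBulkMidLocalToGlobalSandwichH0

/-!
# Local-to-global Hessian sandwich — `C²` REGULARITY of the extension (whitened frame)
# (crux idea `logconcave-core-extension` on ⟨stmt-QuantumFields-24006⟩, first lemma P2 in consumable form)

`localToGlobal_whitened_C2`: the same statement as `localToGlobal_whitened` (sibling file
`…AllWindowsColdBoxBulkMidLocalToGlobalSandwich`) with the stronger conclusion `ContDiff ℝ 2 A` — the explicit
extension `A = T + smoothTransition((4ρ² − |y−x₀|²)/(3ρ²))·(Φ − T)` is `C²` because `Φ`, the isotropic model `T`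
and the radial cutoff are.  This is what lets the extension be fed to the `C²` sub-Gaussian bound
`SandwichVariancePinching.expMoment_le_of_sandwich(_posDef)` (pieces P2 + P3(b) of the card compose).  The proof of
the sandwich is the one of the sibling file, repeated verbatim (the landed statement hides `A` behind `∃`).

HONEST SCOPE.  Free-hands work of the LEAD seat of ⟨stmt-QuantumFields-24006⟩ (FCL lineage) on the first lemma of an
UN-TRIAGED crux idea card; pure calculus.  No stub of LINE-18, no crux, rung or summit is proved; the Yang–Mills mass
gap is NOT proved by any of this.
-/

noncomputable section

namespace Summit.QuantumFields.YangMills.Theorems.LocalToGlobalSandwich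

open Real Filter Topology Set
open Summit.QuantumFields.YangMills.Theorems.SandwichVariancePinching

variable {n : ℕ}

/-- **LOCAL-TO-GLOBAL HESSIAN SANDWICH with `C²` extension, whitened frame** (constant `C·r`, `C` universal). [folklore] -/
theorem localToGlobal_whitened_C2 : ∃ C : ℝ, 0 ≤ C ∧ ∀ (n : ℕ) (Φ : (Fin n → ℝ) → ℝ), ContDiff ℝ 2 Φ →
    ∀ (r ρ : ℝ), 0 ≤ r → 0 < ρ → ∀ x₀ : Fin n → ℝ,
      (∀ z, (z - x₀) ⬝ᵥ (z - x₀) ≤ 4 * ρ ^ 2 → ∀ v, fderiv ℝ (fderiv ℝ Φ) z v v ≤ (1 + r) * (v ⬝ᵥ v)) →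
      (∀ z, (z - x₀) ⬝ᵥ (z - x₀) ≤ 4 * ρ ^ 2 → ∀ v, (1 - r) * (v ⬝ᵥ v) ≤ fderiv ℝ (fderiv ℝ Φ) z v v) →
      ∃ A : (Fin n → ℝ) → ℝ, ContDiff ℝ 2 A ∧ (∀ y, (y - x₀) ⬝ᵥ (y - x₀) ≤ ρ ^ 2 → A y = Φ y) ∧
        ∀ x h : Fin n → ℝ, (1 - C * r) * (h ⬝ᵥ h) ≤ A (x + h) + A (x - h) - 2 * A x ∧
          A (x + h) + A (x - h) - 2 * A x ≤ (1 + C * r) * (h ⬝ᵥ h) := by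
  obtain ⟨M₁, M₂, hM₁, hM₂, hd1b, hd2b⟩ := exists_bounds_deriv_smoothTransition
  obtain ⟨hsTd, hd1d, _⟩ := smoothTransition_deriv_facts
  refine ⟨1 + 20 / 3 * M₁ + 32 / 9 * M₂, by positivity, ?_⟩
  intro n Φ hΦ r ρ hr hρ x₀ hup hlo
  set C₀ : ℝ := 1 + 20 / 3 * M₁ + 32 / 9 * M₂ with hC₀
  -- the model, the cutoff argument and the extension
  set T : (Fin n → ℝ) → ℝ := fun y => Φ x₀ + fderiv ℝ Φ x₀ (y - x₀) + 1 / 2 * ((y - x₀) ⬝ᵥ (y - x₀))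
    with hT
  set Q : (Fin n → ℝ) → ℝ := fun y => (4 * ρ ^ 2 - (y - x₀) ⬝ᵥ (y - x₀)) / (3 * ρ ^ 2) with hQ
  set A : (Fin n → ℝ) → ℝ := fun y => T y + Real.smoothTransition (Q y) * (Φ y - T y) with hA
  have hρ2 : 0 < 3 * ρ ^ 2 := by positivity
  refine ⟨A, ?_, ?_, ?_⟩
  · -- `C²` regularity
    have hsub : ContDiff ℝ 2 fun y : Fin n → ℝ => y - x₀ := contDiff_id.sub contDiff_const
    have hdot : ContDiff ℝ 2 fun y : Fin n → ℝ => (y - x₀) ⬝ᵥ (y - x₀) := by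
      have e : (fun y : Fin n → ℝ => (y - x₀) ⬝ᵥ (y - x₀)) = fun y => ∑ i, (y i - x₀ i) * (y i - x₀ i) := by
        funext y; simp [dotProduct]
      rw [e]
      exact ContDiff.sum fun i _ =>
        ((contDiff_apply ℝ ℝ i).sub contDiff_const).mul ((contDiff_apply ℝ ℝ i).sub contDiff_const)
    have hTc : ContDiff ℝ 2 T :=
      (contDiff_const.add ((fderiv ℝ Φ x₀).contDiff.comp hsub)).add (contDiff_const.mul hdot)
    have hQc : ContDiff ℝ 2 Q := (contDiff_const.sub hdot).div_const _
    exact hTc.add ((Real.smoothTransition.contDiff.comp hQc).mul (hΦ.sub hTc))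
  · -- agreement on the inner ball
    intro y hy
    have hQ1 : 1 ≤ Q y := by
      simp only [hQ]
      rw [le_div_iff₀ hρ2]
      linarith
    simp only [hA]
    rw [Real.smoothTransition.one_of_one_le hQ1]
    ring
  · -- the global sandwich along the line `t ↦ x + t•h`
    intro x w
    set p : ℝ := w ⬝ᵥ w with hp
    set a : ℝ := (x - x₀) ⬝ᵥ (x - x₀) with ha
    set b : ℝ := (x - x₀) ⬝ᵥ w with hb
    set L : ℝ := fderiv ℝ Φ x₀ w with hL
    set L₀ : ℝ := fderiv ℝ Φ x₀ (x - x₀) with hL₀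
    have hp0 : 0 ≤ p := by simpa [hp] using dotProduct_self_star_nonneg w
    -- line functions
    set q : ℝ → ℝ := fun t => (4 * ρ ^ 2 - (a + 2 * b * t + p * t ^ 2)) / (3 * ρ ^ 2) with hq
    set q' : ℝ → ℝ := fun t => -(2 * b + 2 * p * t) / (3 * ρ ^ 2) with hq'
    set q'' : ℝ := -(2 * p) / (3 * ρ ^ 2) with hq''
    set d1 := deriv Real.smoothTransition with hd1
    set d2 := deriv (deriv Real.smoothTransition) with hd2
    set c : ℝ → ℝ := fun t => Real.smoothTransition (q t) with hc
    set c' : ℝ → ℝ := fun t => d1 (q t) * q' t with hc'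
    set c'' : ℝ → ℝ := fun t => d2 (q t) * q' t ^ 2 + d1 (q t) * q'' with hc''
    set γ : ℝ → ℝ := fun t => Φ (x + t • w) - (Φ x₀ + (L₀ + t * L) + 1 / 2 * (a + 2 * b * t + p * t ^ 2))
      with hγ
    set γ' : ℝ → ℝ := fun t => fderiv ℝ Φ (x + t • w) w - L - (b + p * t) with hγ'
    set γ'' : ℝ → ℝ := fun t => fderiv ℝ (fderiv ℝ Φ) (x + t • w) w w - p with hγ''
    set F : ℝ → ℝ := fun t => (Φ x₀ + (L₀ + t * L) + 1 / 2 * (a + 2 * b * t + p * t ^ 2)) + c t * γ t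
      with hF
    set F' : ℝ → ℝ := fun t => (L + (b + p * t)) + (c' t * γ t + c t * γ' t) with hF'
    set F'' : ℝ → ℝ := fun t => p + (c'' t * γ t + 2 * (c' t * γ' t) + c t * γ'' t) with hF''
    -- derivatives of the polynomial pieces
    have hpoly : ∀ t, HasDerivAt (fun s : ℝ => a + 2 * b * s + p * s ^ 2) (2 * b + 2 * p * t) t := by
      intro t
      have h1 : HasDerivAt (fun s : ℝ => 2 * b * s) (2 * b) t := by
        simpa using (hasDerivAt_id t).const_mul (2 * b)
      have h2 : HasDerivAt (fun s : ℝ => p * s ^ 2) (p * (2 * t)) t := by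
        simpa using (hasDerivAt_pow 2 t).const_mul p
      have h := ((hasDerivAt_const t a).add h1).add h2
      have e : (0:ℝ) + 2 * b + p * (2 * t) = 2 * b + 2 * p * t := by ring
      rw [e] at h
      exact h
    have hqd : ∀ t, HasDerivAt q (q' t) t := by
      intro t
      have h := ((hasDerivAt_const t (4 * ρ ^ 2)).sub (hpoly t)).div_const (3 * ρ ^ 2)
      have e : ((0:ℝ) - (2 * b + 2 * p * t)) / (3 * ρ ^ 2) = q' t := by simp only [hq']; ring
      rw [e] at h
      exact h
    have hq'd : ∀ t, HasDerivAt q' q'' t := by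
      intro t
      have h1 : HasDerivAt (fun s : ℝ => 2 * b + 2 * p * s) (2 * p) t := by
        simpa using ((hasDerivAt_id t).const_mul (2 * p)).const_add (2 * b)
      have h := h1.neg.div_const (3 * ρ ^ 2)
      exact h
    -- derivatives of the cutoff along the line
    have hcd : ∀ t, HasDerivAt c (c' t) t := fun t =>
      ((hsTd (q t)).hasDerivAt.comp t (hqd t))
    have hc'd : ∀ t, HasDerivAt c' (c'' t) t := by
      intro t
      have h1 : HasDerivAt (fun s => d1 (q s)) (d2 (q t) * q' t) t :=
        (hd1d (q t)).hasDerivAt.comp t (hqd t)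
      have h := h1.mul (hq'd t)
      have e : d2 (q t) * q' t * q' t + d1 (q t) * q'' = c'' t := by simp only [hc'']; ring
      rw [e] at h
      exact h
    -- derivatives of `γ`
    have hγd : ∀ t, HasDerivAt γ (γ' t) t := by
      intro t
      have h1 := meanMode_hasDerivAt_comp_path hΦ x w t
      have h2 : HasDerivAt (fun s : ℝ => L₀ + s * L) L t := by
        simpa using (hasDerivAt_mul_const L (x := t)).const_add L₀
      have h3 : HasDerivAt (fun s : ℝ => 1 / 2 * (a + 2 * b * s + p * s ^ 2)) (1 / 2 * (2 * b + 2 * p * t)) t :=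
        (hpoly t).const_mul (1 / 2)
      have h := h1.sub (((hasDerivAt_const t (Φ x₀)).add h2).add h3)
      have e : fderiv ℝ Φ (x + t • w) w - (0 + L + 1 / 2 * (2 * b + 2 * p * t)) = γ' t := by
        simp only [hγ']; ring
      rw [e] at h
      exact h
    have hγ'd : ∀ t, HasDerivAt γ' (γ'' t) t := by
      intro t
      have h1 := meanMode_hasDerivAt_fderiv_comp_path hΦ x w w t
      have h2 : HasDerivAt (fun s : ℝ => b + p * s) p t := by
        simpa using ((hasDerivAt_id t).const_mul p).const_add b
      have h := (h1.sub (hasDerivAt_const t L)).sub h2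
      have e : fderiv ℝ (fderiv ℝ Φ) (x + t • w) w w - 0 - p = γ'' t := by simp only [hγ'']; ring
      rw [e] at h
      exact h
    -- derivatives of `F`
    have hFd : ∀ t, HasDerivAt F (F' t) t := by
      intro t
      have h2 : HasDerivAt (fun s : ℝ => L₀ + s * L) L t := by
        simpa using (hasDerivAt_mul_const L (x := t)).const_add L₀
      have h3 : HasDerivAt (fun s : ℝ => 1 / 2 * (a + 2 * b * s + p * s ^ 2)) (1 / 2 * (2 * b + 2 * p * t)) t :=
        (hpoly t).const_mul (1 / 2)
      have hTl := ((hasDerivAt_const t (Φ x₀)).add h2).add h3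
      have hprod := (hcd t).mul (hγd t)
      have h := hTl.add hprod
      have e : 0 + L + 1 / 2 * (2 * b + 2 * p * t) + (c' t * γ t + c t * γ' t) = F' t := by
        simp only [hF']; ring
      rw [e] at h
      exact h
    have hF'd : ∀ t, HasDerivAt F' (F'' t) t := by
      intro t
      have h1 : HasDerivAt (fun s : ℝ => L + (b + p * s)) p t := by
        have := ((hasDerivAt_id t).const_mul p).const_add b
        simpa using this.const_add L
      have h2 := ((hc'd t).mul (hγd t)).add ((hcd t).mul (hγ'd t))
      have h := h1.add h2
      have e : p + (c'' t * γ t + c' t * γ' t + (c' t * γ' t + c t * γ'' t)) = F'' t := by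
        simp only [hF'']; ring
      rw [e] at h
      exact h
    -- `A` along the line is `F`
    have hAF : ∀ t, A (x + t • w) = F t := by
      intro t
      have e1 : fderiv ℝ Φ x₀ (x + t • w - x₀) = L₀ + t * L := by
        rw [show x + t • w - x₀ = (x - x₀) + t • w by abel, map_add, map_smul, smul_eq_mul]
      have e2 := dot_line_expand x x₀ w t
      rw [← ha, ← hb, ← hp] at e2
      show T (x + t • w) + Real.smoothTransition (Q (x + t • w)) * (Φ (x + t • w) - T (x + t • w)) = F t
      have eT : T (x + t • w) = Φ x₀ + (L₀ + t * L) + 1 / 2 * (a + 2 * b * t + p * t ^ 2) := by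
        show Φ x₀ + fderiv ℝ Φ x₀ (x + t • w - x₀) + 1 / 2 * ((x + t • w - x₀) ⬝ᵥ (x + t • w - x₀)) = _
        rw [e1, e2]
      have eQ : Q (x + t • w) = q t := by
        show (4 * ρ ^ 2 - (x + t • w - x₀) ⬝ᵥ (x + t • w - x₀)) / (3 * ρ ^ 2) = _
        rw [e2]
      rw [eT, eQ]
    -- the bound on the non-quadratic part of `F''`
    have hE : ∀ t, |c'' t * γ t + 2 * (c' t * γ' t) + c t * γ'' t| ≤ C₀ * r * p := by
      intro t
      set z := x + t • w with hz
      set D : ℝ := (z - x₀) ⬝ᵥ (z - x₀) with hD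
      have hDe : D = a + 2 * b * t + p * t ^ 2 := by rw [hD, hz]; exact dot_line_expand x x₀ w t
      rcases le_or_gt D (4 * ρ ^ 2) with hin | hout
      · -- inside the outer ball
        have hD0 : 0 ≤ D := by simpa [hD] using dotProduct_self_star_nonneg (z - x₀)
        have hsD : Real.sqrt D ≤ 2 * ρ := by
          rw [Real.sqrt_le_left (by positivity)]; nlinarith
        have hsp : Real.sqrt p * Real.sqrt p = p := Real.mul_self_sqrt hp0
        -- `γ, γ', γ''`
        have hγb : |γ t| ≤ r / 2 * D := by
          have h := abs_taylor2_le_of_ball hΦ x₀ hup hlo hin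
          have e : Φ z - Φ x₀ - fderiv ℝ Φ x₀ (z - x₀) - 1 / 2 * ((z - x₀) ⬝ᵥ (z - x₀)) = γ t := by
            have e1 : fderiv ℝ Φ x₀ (z - x₀) = L₀ + t * L := by
              rw [show z - x₀ = (x - x₀) + t • w by rw [hz]; abel, map_add, map_smul, smul_eq_mul]
            rw [e1, ← hD, hDe]
            simp only [hγ, hz]
            ring
          rw [e] at h
          exact h
        have hγ'b : |γ' t| ≤ r * (2 * ρ) * Real.sqrt p := by
          have h := abs_fderiv_defect_le_of_ball hΦ hr x₀ hup hlo hin w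
          have e : fderiv ℝ Φ z w - fderiv ℝ Φ x₀ w - (z - x₀) ⬝ᵥ w = γ' t := by
            have e0 : (z - x₀) ⬝ᵥ w = b + p * t := by rw [hz, dot_line_linear x x₀ w t]
            rw [e0]
          rw [e, ← hD] at h
          calc |γ' t| ≤ r * Real.sqrt D * Real.sqrt p := h
            _ ≤ r * (2 * ρ) * Real.sqrt p := by gcongr
        have hγ''b : |γ'' t| ≤ r * p := by
          have hu := hup z hin w
          have hl := hlo z hin w
          rw [hz, ← hp] at hu hl
          show |fderiv ℝ (fderiv ℝ Φ) (x + t • w) w w - p| ≤ r * p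
          rw [abs_le]; constructor <;> linarith
        -- `c, c', c''`
        have hcb : |c t| ≤ 1 := by
          simp only [hc]
          rw [abs_of_nonneg (Real.smoothTransition.nonneg _)]
          exact Real.smoothTransition.le_one _
        have hq'b : |q' t| ≤ 4 * Real.sqrt p / (3 * ρ) := by
          have h1 : |b + p * t| ≤ Real.sqrt D * Real.sqrt p := by
            have e0 : (z - x₀) ⬝ᵥ w = b + p * t := by rw [hz, dot_line_linear x x₀ w t]
            have := abs_dotProduct_le_sqrt_mul_sqrt (z - x₀) w
            rwa [e0] at this
          have h2 : |q' t| = 2 * |b + p * t| / (3 * ρ ^ 2) := by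
            simp only [hq']
            rw [abs_div, abs_neg, abs_of_pos hρ2, show 2 * b + 2 * p * t = 2 * (b + p * t) by ring,
              abs_mul, abs_of_pos (by norm_num : (0:ℝ) < 2)]
          rw [h2, div_le_div_iff₀ hρ2 (by positivity)]
          have h3 : |b + p * t| ≤ 2 * ρ * Real.sqrt p :=
            h1.trans (mul_le_mul_of_nonneg_right hsD (Real.sqrt_nonneg _))
          nlinarith [h3, hρ, Real.sqrt_nonneg p]
        have hc'b : |c' t| ≤ M₁ * (4 * Real.sqrt p / (3 * ρ)) := by
          simp only [hc']
          rw [abs_mul]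
          exact mul_le_mul (hd1b _) hq'b (abs_nonneg _) hM₁
        have hc''b : |c'' t| ≤ M₂ * (16 * p / (9 * ρ ^ 2)) + M₁ * (2 * p / (3 * ρ ^ 2)) := by
          simp only [hc'']
          have h1 : |d2 (q t) * q' t ^ 2| ≤ M₂ * (16 * p / (9 * ρ ^ 2)) := by
            rw [abs_mul, abs_pow]
            have hsq : |q' t| ^ 2 ≤ (4 * Real.sqrt p / (3 * ρ)) ^ 2 :=
              pow_le_pow_left₀ (abs_nonneg _) hq'b 2
            have e : (4 * Real.sqrt p / (3 * ρ)) ^ 2 = 16 * p / (9 * ρ ^ 2) := by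
              rw [div_pow, mul_pow, Real.sq_sqrt hp0]; ring
            rw [e] at hsq
            exact mul_le_mul (hd2b _) hsq (by positivity) hM₂
          have h2 : |d1 (q t) * q''| ≤ M₁ * (2 * p / (3 * ρ ^ 2)) := by
            rw [abs_mul]
            have e : |q''| = 2 * p / (3 * ρ ^ 2) := by
              simp only [hq'']
              rw [abs_div, abs_neg, abs_of_nonneg (by positivity), abs_of_pos hρ2]
            rw [e]
            exact mul_le_mul (hd1b _) le_rfl (by positivity) hM₁
          exact (abs_add_le _ _).trans (add_le_add h1 h2)
        -- assemble
        have t1 : |c'' t * γ t| ≤ (M₂ * (16 * p / (9 * ρ ^ 2)) + M₁ * (2 * p / (3 * ρ ^ 2))) * (r / 2 * D) := by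
          rw [abs_mul]; exact mul_le_mul hc''b hγb (abs_nonneg _) (by positivity)
        have t2 : |2 * (c' t * γ' t)| ≤ 2 * ((M₁ * (4 * Real.sqrt p / (3 * ρ))) * (r * (2 * ρ) * Real.sqrt p)) := by
          rw [abs_mul, abs_of_pos (by norm_num : (0:ℝ) < 2), abs_mul]
          exact mul_le_mul_of_nonneg_left (mul_le_mul hc'b hγ'b (abs_nonneg _) (by positivity)) (by norm_num)
        have t3 : |c t * γ'' t| ≤ 1 * (r * p) := by
          rw [abs_mul]; exact mul_le_mul hcb hγ''b (abs_nonneg _) zero_le_one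
        have hsum := (abs_add_le _ _).trans (add_le_add ((abs_add_le _ _).trans (add_le_add t1 t2)) t3)
        refine hsum.trans ?_
        have e2 : 2 * ((M₁ * (4 * Real.sqrt p / (3 * ρ))) * (r * (2 * ρ) * Real.sqrt p)) = 16 / 3 * M₁ * r * p := by
          rw [show 2 * ((M₁ * (4 * Real.sqrt p / (3 * ρ))) * (r * (2 * ρ) * Real.sqrt p)) =
            16 / 3 * M₁ * r * (Real.sqrt p * Real.sqrt p) * (ρ / ρ) by ring, hsp, div_self hρ.ne', mul_one]
        rw [e2] at t2
        have hDb : D ≤ 4 * ρ ^ 2 := hin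
        have e1 : (M₂ * (16 * p / (9 * ρ ^ 2)) + M₁ * (2 * p / (3 * ρ ^ 2))) * (r / 2 * (4 * ρ ^ 2)) =
            (32 / 9 * M₂ + 4 / 3 * M₁) * r * p := by
          have hρ0 : ρ ^ 2 ≠ 0 := by positivity
          field_simp
          ring
        have t1' : (M₂ * (16 * p / (9 * ρ ^ 2)) + M₁ * (2 * p / (3 * ρ ^ 2))) * (r / 2 * D) ≤
            (32 / 9 * M₂ + 4 / 3 * M₁) * r * p := by
          rw [← e1]
          exact mul_le_mul_of_nonneg_left (mul_le_mul_of_nonneg_left hDb (by positivity)) (by positivity)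
        have efin : (32 / 9 * M₂ + 4 / 3 * M₁) * r * p + 16 / 3 * M₁ * r * p + 1 * (r * p) = C₀ * r * p := by
          rw [hC₀]; ring
        linarith [t1', t1, t2, t3, efin]
      · -- outside the outer ball: the cutoff and its derivatives vanish
        have hqneg : q t < 0 := by
          simp only [hq]
          rw [div_neg_iff]
          right
          exact ⟨by rw [← hDe]; linarith, hρ2⟩
        obtain ⟨h0, h1, h2⟩ := smoothTransition_derivs_zero_of_neg hqneg
        have hc0 : c t = 0 := by simp only [hc]; exact h0
        have hc'0 : c' t = 0 := by simp only [hc', hd1]; rw [h1, zero_mul]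
        have hc''0 : c'' t = 0 := by simp only [hc'', hd1, hd2]; rw [h1, h2, zero_mul, zero_mul, add_zero]
        rw [hc0, hc'0, hc''0]
        simp only [zero_mul, mul_zero, add_zero, abs_zero]
        positivity
    -- conclude with the one-dimensional lemma
    have hup1 : ∀ t, F'' t ≤ (1 + C₀ * r) * p := fun t => by
      have := (abs_le.mp (hE t)).2
      simp only [hF'']; linarith
    have hlo1 : ∀ t, (1 - C₀ * r) * p ≤ F'' t := fun t => by
      have := (abs_le.mp (hE t)).1
      simp only [hF'']; linarith
    have hU := oneD_secondDiff_le hFd hF'd hup1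
    have hL' := oneD_le_secondDiff hFd hF'd hlo1
    have e1 : A (x + w) = F 1 := by rw [← hAF 1, one_smul]
    have e2 : A (x - w) = F (-1) := by rw [← hAF (-1), neg_one_smul, sub_eq_add_neg]
    have e3 : A x = F 0 := by rw [← hAF 0, zero_smul, add_zero]
    rw [e1, e2, e3]
    exact ⟨hL', hU⟩

end Summit.QuantumFields.YangMills.Theorems.LocalToGlobalSandwich

end
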